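import Literature.NumberTheory.EllipticCurves.WeierstrassAdditionProofs
import Literature.NumberTheory.EllipticCurves.LatticeJInvariant
import HarnessLib

/-!
# Transformations of `℘` of order two and three, and complex multiplication of norm two and three

Topic `Literature/NumberTheory/EllipticCurves`; dot-notation extensions of Mathlib's `PeriodPair`
(as in `RealLatticePeriod.lean`, `LatticeJInvariant.lean`).  Everything in this file is **proved**
(no named facts); it is level 4 of the decomposition of
`Literature.NumberTheory.EllipticCurves.finite_point_of_j_mem_maximalCMJInvariants_of_L_one_ne_zero` (Coates–Wiles 1977, Thm. 1),
serving its singular-moduli leaf `Literature.NumberTheory.EllipticCurves.singularModuli_classNumberOne` (Cox, *Primes of the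
form x² + ny²*, table (12.20); `ComplexMultiplicationSingularModuli.lean`): the rows `d = −8`
(`j(√−2) = 8000`), `d = −7` (`j((1 + √−7)/2) = −3375`) and `d = −11` (`j((1 + √−11)/2) = −32768`)
follow from the three `j`-value theorems below (`ComplexMultiplicationSingularModuliRows.lean`).

Let `Λ ⊂ Λ'` be lattices (two period pairs `L, L'`), `℘ = ℘_Λ`, `e = ℘(w)`,
`G_k = G_k(Λ) = Σ' λ⁻ᵏ` (Mathlib `PeriodPair.G`), `g₂ = 60G₄`, `g₃ = 140G₆`.

**Order two.**  `Λ' = Λ ∪ (w + Λ)`, `w ∉ Λ` (so `2w ∈ Λ`), encoded as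
`∀ x, x ∈ Λ' ↔ x ∈ Λ ∨ x − w ∈ Λ`:

* `PeriodPair.weierstrassP_of_indexTwo` : `℘_{Λ'}(z) = ℘(z) + ℘(z − w) − e` off `Λ'` — Lawden,
  *Elliptic Functions and Applications*, §9.8, eqs. (9.8.6)–(9.8.7)
  (`℘(u | ω₁, ½ω₃) = ℘(u) + ℘(u + ω₃) − e₃`, "as also follows directly by application of Liouville's
  theorem"); proved exactly so: the difference is `Λ`-periodic and entire
  (`PeriodPair.indexTwoAux`; Mathlib's `IsZLattice.isCompact_range_of_periodic` +
  `Differentiable.apply_eq_apply_of_bounded`, the pattern of Mathlib's proof of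
  `PeriodPair.derivWeierstrassP_sq`).
* `PeriodPair.weierstrassP_sub_halfPeriod` : `℘(z − w) = e + (3e² − g₂/4)/(℘(z) − e)` — Lawden
  (6.8.11) (`℘(u + ω₁) = e₁ + (e₁ − e₂)(e₁ − e₃)/(℘(u) − e₁)`,
  `(e₁ − e₂)(e₁ − e₃) = 3e₁² − g₂/4`), from the addition theorem
  (`PeriodPair.weierstrassP_add_holds`, tree) with `℘'(w) = 0`, `℘'² = 4℘³ − g₂℘ − g₃`.
* `PeriodPair.weierstrassP_sub_mul_sub_of_indexTwo` : `(℘_{Λ'} − ℘)(℘ − e) = 3e² − g₂/4` —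
  Lawden (9.8.8).
* `PeriodPair.g₂_of_indexTwo`, `PeriodPair.g₃_of_indexTwo` : **the invariants of the transformed
  function**, `g₂(Λ') = 60e² − 4g₂`, `g₃(Λ') = 56e³ + 8g₃` — Lawden (9.8.12)–(9.8.13); read off
  from the Taylor coefficients at `0` of
  `S(z) = (℘⁻_{Λ'} − ℘⁻)(z) · (z²℘⁻(z) + 1 − ez²) = (3e² − g₂/4) z²`, where `℘⁻ = ℘ − z⁻²` is
  Mathlib's `℘[L - 0]` with its power series `PeriodPair.iteratedDeriv_weierstrassPExcept_self`
  (`PeriodPair.veluAux`; `G₄(Λ') = e² − 4G₄`, `5G₆(Λ') = 5G₆ + 3e³ − 15eG₄`).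

**Order three.**  `Λ' = Λ ∪ (w + Λ) ∪ (−w + Λ)`, `w, 2w ∉ Λ` (so `3w ∈ Λ`):

* `PeriodPair.weierstrassP_of_indexThree` : `℘_{Λ'}(z) = ℘(z) + ℘(z − w) + ℘(z + w) − 2e` —
  the case `n = 3` (Lawden (9.8.14), up to homothety), same Liouville argument;
* `PeriodPair.weierstrassP_add_add_weierstrassP_sub` :
  `℘(z + w) + ℘(z − w) = (2e℘² + (2e² − g₂/2)℘ − (g₂e/2 + g₃))/(℘ − e)²` from the addition
  theorem at `(z, ±w)`;
* `PeriodPair.G_four_of_indexThree`, `PeriodPair.G_six_of_indexThree` : `G₄(Λ') = 2e² − 9G₄`,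
  `G₆(Λ') = 2e³ − 18eG₄ − 27G₆`, from the Taylor coefficients of
  `S₃(z) = (℘⁻_{Λ'} − ℘⁻)(z)(z²℘⁻ + 1 − ez²)² = (6e² − g₂/2)(z⁴℘⁻ + z²) − (2e³ + g₂e/2 + g₃)z⁴`.

**Complex multiplication** (the method of Stark as presented by Cox, §10.C, (10.21)–(10.22):
`℘(αz) = A(℘(z))/B(℘(z))` and comparison of Laurent expansions at `0`).  If moreover `Λ' = α⁻¹Λ`
(`αΛ ⊂ Λ` of index `2`, resp. `3`), then `G_k(Λ') = αᵏG_k`, whence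

* `PeriodPair.weierstrassP_sq_of_cmTwo`, `PeriodPair.G_six_of_cmTwo` : `e² = (α⁴ + 4)G₄`,
  `5(α⁶ − 1)G₆ = 3(α⁴ − 1)eG₄`;
* `PeriodPair.j_eq_of_cmTwo_of_sq_eq_neg_two` : `α² = −2` ⇒ `25G₆² = 8G₄³` ⇒ `j(Λ) = 8000` — Cox
  §10.C, "`j(√−2) = 8000`", Exercise 10.19;
* `PeriodPair.j_eq_of_cmTwo_of_sq_eq_self_sub_two` : `α² = α − 2` ⇒ `175G₆² = 108G₄³` ⇒
  `j(Λ) = −3375` — Cox §10.C and Exercise 10.20;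
* `PeriodPair.weierstrassP_sq_of_cmThree`, `PeriodPair.G_six_of_cmThree` :
  `2e² = (α⁴ + 9)G₄`, `(α⁶ + 27)G₆ = (α⁴ − 9)eG₄`;
* `PeriodPair.j_eq_of_cmThree_of_sq_eq_self_sub_three` : `α² = α − 3` ⇒ `128G₆² = 55G₄³` ⇒
  `j(Λ) = −32768` (the value of Cox's table (12.20) for `d_K = −11`, which Cox obtains by the
  `q`-expansion method of §12.C; here by the elementary method of §10.C).

Design notes.  The index hypotheses are stated on the lattices only (membership), so the results
apply to any period pairs spanning `Λ ⊂ Λ'`; for the CM statements `Λ' = α⁻¹Λ` is realised as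
`L.mulLeft α⁻¹` (`RealLatticePeriod.lean`).  `j` is `PeriodPair.j = 1728g₂³/(g₂³ − 27g₃²)`
(`LatticeJInvariant.lean`, Cox (10.8)); `g₂³ − 27g₃² ≠ 0` is `PeriodPair.discr_ne_zero`.  The
identification of the germs `S = (3e² − g₂/4)z²`, `S₃ = R₃` on a full neighbourhood of `0` uses
the principle of isolated zeros (`AnalyticAt.eventually_eq_zero_or_eventually_ne_zero`).

## References

* D. F. Lawden, *Elliptic Functions and Applications*, Applied Math. Sciences 80, Springer 1989:
  §6.8 eqs. (6.8.10)–(6.8.11); §9.8 eqs. (9.8.6)–(9.8.8), (9.8.12)–(9.8.14) (PDF pp. 166, 246–247).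
* D. A. Cox, *Primes of the form x² + ny²*, 2nd ed., Wiley 2013: §10.C, eqs. (10.21)–(10.22)
  ("following the exposition of Stark", `j(√−2) = 8000`, `j((1 + √−7)/2) = −3375`), §10.D
  Exercises 10.19–10.20 (PDF pp. 223–224, 229); §12.C table (12.20) (PDF pp. 266–267).
-/

noncomputable section

open scoped Topology
open Filter Set Complex

namespace PeriodPair

variable {L L' : PeriodPair} {w : ℂ}

/-- Translates of `℘` are analytic off the translated lattice. [folklore] -/
lemma analyticAt_weierstrassP_sub_const (L : PeriodPair) (c : ℂ) {x : ℂ} (hx : x - c ∉ L.lattice) :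
    AnalyticAt ℂ (fun z ↦ ℘[L] (z - c)) x := by
  have ht : AnalyticAt ℂ (fun z : ℂ ↦ z - c) x := by fun_prop
  have := (L.analyticOnNhd_weierstrassP (x - c) hx).comp_of_eq ht rfl
  rwa [Function.comp_def] at this

/-- Translates of `℘⁻ = ℘[L - 0]` are analytic at the translation point. [folklore] -/
lemma analyticAt_weierstrassPExcept_sub_const (L : PeriodPair) (c : ℂ) :
    AnalyticAt ℂ (fun z ↦ ℘[L - (0 : ℂ)] (z - c)) c := by
  have ht : AnalyticAt ℂ (fun z : ℂ ↦ z - c) c := by fun_prop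
  have := (L.analyticAt_weierstrassPExcept (0 : ℂ)).comp_of_eq ht (sub_self c)
  rwa [Function.comp_def] at this

/-! ### Lattices of index two: `Λ' = Λ ∪ (w + Λ)` -/

section IndexTwo

/-- `Λ ≤ Λ'` when `Λ' = Λ ∪ (w + Λ)`. [folklore] -/
lemma le_of_indexTwo (hΛ : ∀ x, x ∈ L'.lattice ↔ x ∈ L.lattice ∨ x - w ∈ L.lattice) :
    L.lattice ≤ L'.lattice := fun x hx ↦ (hΛ x).mpr (Or.inl hx)

/-- `w ∈ Λ'` when `Λ' = Λ ∪ (w + Λ)`. [folklore] -/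
lemma w_mem_of_indexTwo (hΛ : ∀ x, x ∈ L'.lattice ↔ x ∈ L.lattice ∨ x - w ∈ L.lattice) :
    w ∈ L'.lattice := (hΛ w).mpr (Or.inr (by simp))

/-- `2w ∈ Λ` when `Λ' = Λ ∪ (w + Λ)` and `w ∉ Λ`. [folklore] -/
lemma two_mul_w_mem_of_indexTwo (hΛ : ∀ x, x ∈ L'.lattice ↔ x ∈ L.lattice ∨ x - w ∈ L.lattice)
    (hw : w ∉ L.lattice) : 2 * w ∈ L.lattice := by
  have h2 : 2 * w ∈ L'.lattice := by
    rw [two_mul]; exact add_mem (w_mem_of_indexTwo hΛ) (w_mem_of_indexTwo hΛ)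
  rcases (hΛ _).mp h2 with h | h
  · exact h
  · rw [show 2 * w - w = w by ring] at h
    exact absurd h hw

/-- If `z ∉ Λ'` then `z ∉ Λ`. [folklore] -/
lemma notMem_of_notMem_of_indexTwo
    (hΛ : ∀ x, x ∈ L'.lattice ↔ x ∈ L.lattice ∨ x - w ∈ L.lattice) {z : ℂ}
    (hz : z ∉ L'.lattice) : z ∉ L.lattice := fun h ↦ hz (le_of_indexTwo hΛ h)

/-- If `z ∉ Λ'` then `z - w ∉ Λ`. [folklore] -/
lemma sub_notMem_of_notMem_of_indexTwo
    (hΛ : ∀ x, x ∈ L'.lattice ↔ x ∈ L.lattice ∨ x - w ∈ L.lattice) {z : ℂ}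
    (hz : z ∉ L'.lattice) : z - w ∉ L.lattice := fun h ↦ hz ((hΛ z).mpr (Or.inr h))

/-- If `z ∉ Λ'` then `z + w ∉ Λ` (as `2w ∈ Λ`). [folklore] -/
lemma add_notMem_of_notMem_of_indexTwo
    (hΛ : ∀ x, x ∈ L'.lattice ↔ x ∈ L.lattice ∨ x - w ∈ L.lattice) (hw : w ∉ L.lattice) {z : ℂ}
    (hz : z ∉ L'.lattice) : z + w ∉ L.lattice := by
  intro h
  apply sub_notMem_of_notMem_of_indexTwo hΛ hz
  have : z - w = z + w - 2 * w := by ring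
  rw [this]
  exact sub_mem h (two_mul_w_mem_of_indexTwo hΛ hw)

/-- The auxiliary function of the Liouville argument for the index-two formula:
`℘_{Λ'}(z) - ℘_Λ(z) - ℘_Λ(z - w)` off `Λ'`, extended by `-℘_Λ(w)` on `Λ'`. [folklore] -/
def indexTwoAux (L L' : PeriodPair) (w : ℂ) (z : ℂ) : ℂ :=
  letI := Classical.propDecidable
  if z ∈ L'.lattice then -℘[L] w else ℘[L'] z - ℘[L] z - ℘[L] (z - w)

/-- Value of the auxiliary function on `Λ'`. [folklore] -/
lemma indexTwoAux_of_mem {z : ℂ} (hz : z ∈ L'.lattice) : indexTwoAux L L' w z = -℘[L] w := by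
  classical simp [indexTwoAux, hz]

/-- Value of the auxiliary function off `Λ'`. [folklore] -/
lemma indexTwoAux_of_notMem {z : ℂ} (hz : z ∉ L'.lattice) :
    indexTwoAux L L' w z = ℘[L'] z - ℘[L] z - ℘[L] (z - w) := by
  classical simp [indexTwoAux, hz]

/-- `Λ`-periodicity of the auxiliary function. [folklore] -/
lemma indexTwoAux_add_coe (hΛ : ∀ x, x ∈ L'.lattice ↔ x ∈ L.lattice ∨ x - w ∈ L.lattice)
    (z : ℂ) (l : L.lattice) : indexTwoAux L L' w (z + l) = indexTwoAux L L' w z := by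
  have hl' : (l : ℂ) ∈ L'.lattice := le_of_indexTwo hΛ l.2
  by_cases hz : z ∈ L'.lattice
  · rw [indexTwoAux_of_mem hz, indexTwoAux_of_mem (add_mem hz hl')]
  · have hz' : z + l ∉ L'.lattice := fun h ↦ hz (by simpa using sub_mem h hl')
    rw [indexTwoAux_of_notMem hz, indexTwoAux_of_notMem hz',
      show z + l - w = (z - w) + l by ring, L.weierstrassP_add_coe, L.weierstrassP_add_coe,
      ← Subtype.coe_mk (l : ℂ) hl', L'.weierstrassP_add_coe]

/-- `Λ`-periodicity of the auxiliary function (subtractive form). [folklore] -/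
lemma indexTwoAux_sub_coe (hΛ : ∀ x, x ∈ L'.lattice ↔ x ∈ L.lattice ∨ x - w ∈ L.lattice)
    (z : ℂ) (l : L.lattice) : indexTwoAux L L' w (z - l) = indexTwoAux L L' w z := by
  rw [← indexTwoAux_add_coe hΛ (z - l) l, sub_add_cancel]

/-- Analyticity of the auxiliary function at `0`: near `0` it is
`℘⁻_{Λ'}(z) - ℘⁻_Λ(z) - ℘_Λ(z - w)` (`℘⁻ = ℘ - z⁻²`, Mathlib's `℘[L - 0]`). [folklore] -/
lemma analyticAt_indexTwoAux_zero (L' : PeriodPair) (hw : w ∉ L.lattice) :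
    AnalyticAt ℂ (indexTwoAux L L' w) 0 := by
  have hw' : 0 - w ∉ L.lattice := fun h ↦ hw (by simpa using neg_mem h)
  have hg : AnalyticAt ℂ
      (fun z ↦ ℘[L' - (0 : ℂ)] z - ℘[L - (0 : ℂ)] z - ℘[L] (z - w)) 0 :=
    ((L'.analyticAt_weierstrassPExcept 0).sub (L.analyticAt_weierstrassPExcept 0)).sub
      (L.analyticAt_weierstrassP_sub_const w hw')
  refine hg.congr ?_
  filter_upwards [L'.compl_lattice_sdiff_singleton_mem_nhds 0] with z hz
  by_cases hz0 : z = 0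
  · rw [hz0, indexTwoAux_of_mem (zero_mem _)]
    simp
  · have hzΛ' : z ∉ L'.lattice := fun h ↦ hz ⟨h, hz0⟩
    rw [indexTwoAux_of_notMem hzΛ', L'.weierstrassP_eq_weierstrassPExcept_add z,
      L.weierstrassP_eq_weierstrassPExcept_add z]
    ring

/-- Analyticity of the auxiliary function at `w`: near `w` it is
`℘⁻ʷ_{Λ'}(z) - w⁻² - ℘_Λ(z) - ℘⁻_Λ(z - w)`. [folklore] -/
lemma analyticAt_indexTwoAux_w
    (hΛ : ∀ x, x ∈ L'.lattice ↔ x ∈ L.lattice ∨ x - w ∈ L.lattice) (hw : w ∉ L.lattice) :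
    AnalyticAt ℂ (indexTwoAux L L' w) w := by
  have hwΛ' : w ∈ L'.lattice := w_mem_of_indexTwo hΛ
  have hg : AnalyticAt ℂ
      (fun z ↦ ℘[L' - w] z - 1 / w ^ 2 - ℘[L] z - ℘[L - (0 : ℂ)] (z - w)) w :=
    (((L'.analyticAt_weierstrassPExcept w).sub analyticAt_const).sub
      (L.analyticOnNhd_weierstrassP w hw)).sub (L.analyticAt_weierstrassPExcept_sub_const w)
  refine hg.congr ?_
  filter_upwards [L'.compl_lattice_sdiff_singleton_mem_nhds w] with z hz
  have hdef : ∀ z, ℘[L' - w] z = ℘[L'] z + (1 / w ^ 2 - 1 / (z - w) ^ 2) := fun z ↦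
    L'.weierstrassPExcept_def ⟨w, hwΛ'⟩ z
  by_cases hzw : z = w
  · rw [hzw, indexTwoAux_of_mem hwΛ', hdef, sub_self, L.weierstrassPExcept_zero,
      show ℘[L'] w = 0 from L'.weierstrassP_coe ⟨w, hwΛ'⟩]
    simp
  · have hzΛ' : z ∉ L'.lattice := fun h ↦ hz ⟨h, hzw⟩
    rw [indexTwoAux_of_notMem hzΛ', hdef, L.weierstrassP_eq_weierstrassPExcept_add (z - w)]
    ring

/-- The auxiliary function is entire. [folklore] -/
lemma analyticAt_indexTwoAux
    (hΛ : ∀ x, x ∈ L'.lattice ↔ x ∈ L.lattice ∨ x - w ∈ L.lattice) (hw : w ∉ L.lattice)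
    (x : ℂ) : AnalyticAt ℂ (indexTwoAux L L' w) x := by
  by_cases hx : x ∈ L'.lattice
  · -- reduce to `0` or `w` by `Λ`-periodicity
    have key : ∀ (l : L.lattice) (y : ℂ), AnalyticAt ℂ (indexTwoAux L L' w) y →
        AnalyticAt ℂ (indexTwoAux L L' w) (y + l) := by
      intro l y hy
      have ht : AnalyticAt ℂ (fun z : ℂ ↦ z - l) (y + l) := by fun_prop
      have := hy.comp_of_eq ht (by simp)
      rw [Function.comp_def] at this
      simpa only [indexTwoAux_sub_coe hΛ] using this
    rcases (hΛ x).mp hx with h | h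
    · have := key ⟨x, h⟩ 0 (analyticAt_indexTwoAux_zero L' hw)
      simpa using this
    · have := key ⟨x - w, h⟩ w (analyticAt_indexTwoAux_w hΛ hw)
      simpa using this
  · have hxΛ : x ∉ L.lattice := notMem_of_notMem_of_indexTwo hΛ hx
    have hxw : x - w ∉ L.lattice := sub_notMem_of_notMem_of_indexTwo hΛ hx
    have hg : AnalyticAt ℂ (fun z ↦ ℘[L'] z - ℘[L] z - ℘[L] (z - w)) x :=
      ((L'.analyticOnNhd_weierstrassP x hx).sub (L.analyticOnNhd_weierstrassP x hxΛ)).sub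
        (L.analyticAt_weierstrassP_sub_const w hxw)
    refine hg.congr ?_
    filter_upwards [L'.isClosed_lattice.isOpen_compl.mem_nhds hx] with z hz
    rw [indexTwoAux_of_notMem hz]

/-- The auxiliary function is constant (Liouville). [folklore] -/
lemma indexTwoAux_eq (hΛ : ∀ x, x ∈ L'.lattice ↔ x ∈ L.lattice ∨ x - w ∈ L.lattice)
    (hw : w ∉ L.lattice) (z : ℂ) : indexTwoAux L L' w z = -℘[L] w := by
  have hd : Differentiable ℂ (indexTwoAux L L' w) := fun x ↦
    (analyticAt_indexTwoAux hΛ hw x).differentiableAt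
  have := hd.apply_eq_apply_of_bounded (IsZLattice.isCompact_range_of_periodic L.lattice _
    hd.continuous fun z l hl ↦ by
      lift l to L.lattice using hl; exact indexTwoAux_add_coe hΛ z l).isBounded z 0
  rw [this, indexTwoAux_of_mem (zero_mem _)]

/-- **`℘` of a lattice of index two** (second-order transformation of `℘`).  If
`Λ ⊂ Λ' = Λ ∪ (w + Λ)` with `w ∉ Λ` (so `2w ∈ Λ`), then for `z ∉ Λ'`,
`℘_{Λ'}(z) = ℘_Λ(z) + ℘_Λ(z - w) - ℘_Λ(w)` — Lawden (9.8.6)–(9.8.7):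
`℘(u | ω₁, ½ω₃) = ℘(u | ω₁, ω₃) + ℘(u + ω₃ | ω₁, ω₃) − e₃`, "as also follows directly by application
of Liouville's theorem" (the difference is `Λ`-periodic and entire, `indexTwoAux_eq`).
[cite: Lawden1989, §9.8 eqs. (9.8.6)–(9.8.7)] -/
theorem weierstrassP_of_indexTwo
    (hΛ : ∀ x, x ∈ L'.lattice ↔ x ∈ L.lattice ∨ x - w ∈ L.lattice) (hw : w ∉ L.lattice)
    {z : ℂ} (hz : z ∉ L'.lattice) :
    ℘[L'] z = ℘[L] z + ℘[L] (z - w) - ℘[L] w := by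
  have := indexTwoAux_eq hΛ hw z
  rw [indexTwoAux_of_notMem hz] at this
  linear_combination this

end IndexTwo

/-! ### Addition of a half-period -/

section HalfPeriod

/-- The rational-function identity behind the half-period addition formula:
`(Y/(X−E))²/4 − X − E − (E + (3E² − G₂/4)/(X − E)) = (Y² − (4X³ − G₂X − G₃) + (4E³ − G₂E − G₃))/(4(X − E)²)`.
[folklore] -/
lemma halfPeriod_identity {X Y E G₂ G₃ : ℂ} (h : X - E ≠ 0) :
    (Y / (X - E)) ^ 2 / 4 - X - E - (E + (3 * E ^ 2 - G₂ / 4) / (X - E)) =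
      (Y ^ 2 - (4 * X ^ 3 - G₂ * X - G₃) + (4 * E ^ 3 - G₂ * E - G₃)) / (4 * (X - E) ^ 2) := by
  field_simp
  ring

/-- **Addition of a half-period.**  If `2w ∈ Λ`, `w ∉ Λ`, `e = ℘(w)`, then for `z` with
`z, z - w, z + w ∉ Λ`: `℘(z - w) = e + (3e² - g₂/4)/(℘(z) - e)` — Lawden (6.8.11):
`℘(u + ω₁) = e₁ + (e₁ - e₂)(e₁ - e₃)/(℘(u) - e₁)` (with `(e₁ - e₂)(e₁ - e₃) = 3e₁² - g₂/4` since
`e₁ + e₂ + e₃ = 0`, `e₁e₂ + e₂e₃ + e₃e₁ = -g₂/4`); as printed, from the addition theorem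
(`PeriodPair.weierstrassP_add_holds`) with `℘'(w) = 0`, `℘'² = 4℘³ - g₂℘ - g₃` and
`4e³ - g₂e - g₃ = 0`. [cite: Lawden1989, §6.8 eq. (6.8.11)] -/
theorem weierstrassP_sub_halfPeriod (hw : w ∉ L.lattice) (h2w : 2 * w ∈ L.lattice) {z : ℂ}
    (hz : z ∉ L.lattice) (hzw : z - w ∉ L.lattice) (hzw' : z + w ∉ L.lattice) :
    ℘[L] (z - w) = ℘[L] w + (3 * ℘[L] w ^ 2 - L.g₂ / 4) / (℘[L] z - ℘[L] w) := by
  have hw' : -w ∉ L.lattice := fun h ↦ hw (by simpa using neg_mem h)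
  have hne : ℘[L] z ≠ ℘[L] w := fun h ↦ by
    rcases (L.weierstrassP_eq_weierstrassP_iff hz hw).mp h with h' | h'
    · exact hzw' h'
    · exact hzw h'
  have hne' : ℘[L] z ≠ ℘[L] (-w) := by rwa [L.weierstrassP_neg]
  have h0 : ℘'[L] w = 0 := by
    have := L.derivWeierstrassP_sub_coe w ⟨2 * w, h2w⟩
    rw [Subtype.coe_mk, show w - 2 * w = -w by ring, derivWeierstrassP_neg] at this
    have h2 : (2 : ℂ) * ℘'[L] w = 0 := by linear_combination -this
    simpa using h2
  have hadd := L.weierstrassP_add_holds z (-w) hz hw' hne'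
  rw [L.weierstrassP_neg, L.derivWeierstrassP_neg, h0, neg_zero, sub_zero, ← sub_eq_add_neg]
    at hadd
  have hsq := L.derivWeierstrassP_sq z hz
  have he := L.derivWeierstrassP_sq w hw
  rw [h0] at he
  have hD : ℘[L] z - ℘[L] w ≠ 0 := sub_ne_zero.mpr hne
  have key := halfPeriod_identity (Y := ℘'[L] z) (G₂ := L.g₂) (G₃ := L.g₃) hD
  rw [hsq, ← he, ← hadd] at key
  have : ℘[L] (z - w) - (℘[L] w + (3 * ℘[L] w ^ 2 - L.g₂ / 4) / (℘[L] z - ℘[L] w)) = 0 := by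
    rw [key]; ring
  exact sub_eq_zero.mp this

end HalfPeriod

/-! ### The invariants of a lattice of index two (Lawden (9.8.12)–(9.8.13); Vélu's formulae in degree two) -/

section VeluTwo

/-- Off `Λ'`, `(℘_{Λ'} - ℘_Λ)(℘_Λ - e) = 3e² - g₂/4` (`e = ℘_Λ(w)`): the index-two formula combined
with the half-period addition formula — Lawden (9.8.8):
`℘(u | ω₁, ½ω₃) = ℘(u) + (e₃ − e₁)(e₃ − e₂)/(℘(u) − e₃)`. [cite: Lawden1989, §9.8 eq. (9.8.8)] -/
theorem weierstrassP_sub_mul_sub_of_indexTwo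
    (hΛ : ∀ x, x ∈ L'.lattice ↔ x ∈ L.lattice ∨ x - w ∈ L.lattice) (hw : w ∉ L.lattice)
    {z : ℂ} (hz : z ∉ L'.lattice) :
    (℘[L'] z - ℘[L] z) * (℘[L] z - ℘[L] w) = 3 * ℘[L] w ^ 2 - L.g₂ / 4 := by
  have hzΛ := notMem_of_notMem_of_indexTwo hΛ hz
  have hzw := sub_notMem_of_notMem_of_indexTwo hΛ hz
  have hzw' := add_notMem_of_notMem_of_indexTwo hΛ hw hz
  have hne : ℘[L] z ≠ ℘[L] w := fun h ↦ by
    rcases (L.weierstrassP_eq_weierstrassP_iff hzΛ hw).mp h with h' | h'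
    · exact hzw' h'
    · exact hzw h'
  have hD : ℘[L] z - ℘[L] w ≠ 0 := sub_ne_zero.mpr hne
  rw [weierstrassP_of_indexTwo hΛ hw hz,
    weierstrassP_sub_halfPeriod hw (two_mul_w_mem_of_indexTwo hΛ hw) hzΛ hzw hzw']
  field_simp
  ring

/-- The analytic germ at `0` used to read off Taylor coefficients:
`S(z) = (℘⁻_{Λ'}(z) - ℘⁻_Λ(z)) · (z²℘⁻_Λ(z) + 1 - e z²)` (`℘⁻ = ℘ - z⁻²`). [folklore] -/
def veluAux (L L' : PeriodPair) (e : ℂ) (z : ℂ) : ℂ :=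
  (℘[L' - (0 : ℂ)] z - ℘[L - (0 : ℂ)] z) * (z ^ 2 * ℘[L - (0 : ℂ)] z + 1 - e * z ^ 2)

/-- `S` is analytic at `0`. [folklore] -/
lemma analyticAt_veluAux (L L' : PeriodPair) (e : ℂ) : AnalyticAt ℂ (veluAux L L' e) 0 := by
  unfold veluAux
  fun_prop

/-- Off `0` near `0`, `S(z) = (3e² - g₂/4) z²` when `Λ' = Λ ∪ (w + Λ)`, `e = ℘_Λ(w)`. [folklore] -/
lemma veluAux_eq_of_notMem
    (hΛ : ∀ x, x ∈ L'.lattice ↔ x ∈ L.lattice ∨ x - w ∈ L.lattice) (hw : w ∉ L.lattice)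
    {z : ℂ} (hz : z ∉ L'.lattice) :
    veluAux L L' (℘[L] w) z = (3 * ℘[L] w ^ 2 - L.g₂ / 4) * z ^ 2 := by
  have hz0 : z ≠ 0 := fun h ↦ hz (h ▸ zero_mem _)
  have key := weierstrassP_sub_mul_sub_of_indexTwo hΛ hw hz
  rw [L'.weierstrassP_eq_weierstrassPExcept_add z, L.weierstrassP_eq_weierstrassPExcept_add z]
    at key
  rw [veluAux, ← key]
  field_simp
  ring

/-- Near `0` (including `0`), `S(z) = (3e² - g₂/4) z²` (isolated zeros of analytic functions).
[folklore] -/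
lemma veluAux_eventuallyEq
    (hΛ : ∀ x, x ∈ L'.lattice ↔ x ∈ L.lattice ∨ x - w ∈ L.lattice) (hw : w ∉ L.lattice) :
    veluAux L L' (℘[L] w) =ᶠ[𝓝 0] fun z ↦ (3 * ℘[L] w ^ 2 - L.g₂ / 4) * z ^ 2 := by
  have hT : AnalyticAt ℂ (fun z ↦ veluAux L L' (℘[L] w) z - (3 * ℘[L] w ^ 2 - L.g₂ / 4) * z ^ 2)
      0 := (analyticAt_veluAux L L' _).sub (by fun_prop)
  have hpunct : ∀ᶠ z in 𝓝[≠] (0 : ℂ),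
      veluAux L L' (℘[L] w) z - (3 * ℘[L] w ^ 2 - L.g₂ / 4) * z ^ 2 = 0 := by
    filter_upwards [self_mem_nhdsWithin,
      mem_nhdsWithin_of_mem_nhds (L'.compl_lattice_sdiff_singleton_mem_nhds 0)] with z hz0 hz
    have hzΛ' : z ∉ L'.lattice := fun h ↦ hz ⟨h, hz0⟩
    rw [veluAux_eq_of_notMem hΛ hw hzΛ', sub_self]
  rcases hT.eventually_eq_zero_or_eventually_ne_zero with h | h
  · filter_upwards [h] with z hz
    simpa [sub_eq_zero] using hz
  · exact absurd (h.and hpunct).exists (by simp)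

attribute [local fun_prop] AnalyticAt.contDiffAt in
/-- Second Taylor coefficient of `S` at `0`: `S''(0) = 6 (G₄(Λ') - G₄(Λ))`. [folklore] -/
lemma iteratedDeriv_two_veluAux (L L' : PeriodPair) (e : ℂ) :
    iteratedDeriv 2 (veluAux L L' e) 0 = 6 * (L'.G 4 - L.G 4) := by
  unfold veluAux
  simp (discharger := fun_prop) only [iteratedDeriv_fun_add, iteratedDeriv_fun_sub,
    iteratedDeriv_fun_mul, iteratedDeriv_const, iteratedDeriv_fun_pow_zero,
    iteratedDeriv_weierstrassPExcept_self]
  simp [Finset.sum_range_succ, L.G_eq_zero_of_odd 3 (by decide), L'.G_eq_zero_of_odd 3 (by decide),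
    Nat.factorial]
  ring

attribute [local fun_prop] AnalyticAt.contDiffAt in
/-- Fourth Taylor coefficient of `S` at `0`:
`S⁗(0) = 120 (G₆(Λ') - G₆(Λ)) - 72 e (G₄(Λ') - G₄(Λ))`. [folklore] -/
lemma iteratedDeriv_four_veluAux (L L' : PeriodPair) (e : ℂ) :
    iteratedDeriv 4 (veluAux L L' e) 0 =
      120 * (L'.G 6 - L.G 6) - 72 * e * (L'.G 4 - L.G 4) := by
  unfold veluAux
  simp (discharger := fun_prop) only [iteratedDeriv_fun_add, iteratedDeriv_fun_sub,
    iteratedDeriv_fun_mul, iteratedDeriv_const, iteratedDeriv_fun_pow_zero,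
    iteratedDeriv_weierstrassPExcept_self]
  simp [Finset.sum_range_succ, L.G_eq_zero_of_odd 3 (by decide), L'.G_eq_zero_of_odd 3 (by decide),
    L.G_eq_zero_of_odd 5 (by decide), L'.G_eq_zero_of_odd 5 (by decide), Nat.factorial,
    show Nat.choose 4 2 = 6 by rfl]
  ring

end VeluTwo

section VeluTwoRelations

/-- **Weight four invariant of the lattice of index two**: if `Λ ⊂ Λ' = Λ ∪ (w + Λ)`, `w ∉ Λ`,
`e = ℘_Λ(w)`, then `G₄(Λ') = e² - 4G₄(Λ)` (equivalently `g₂(Λ') = 60e² - 4g₂(Λ)`, Lawden (9.8.12),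
`g₂_of_indexTwo`).  Read off from the `z²`-coefficient of `S(z) = (3e² - g₂/4)z²`.
[cite: Lawden1989, §9.8 eq. (9.8.12)] -/
theorem G_four_of_indexTwo
    (hΛ : ∀ x, x ∈ L'.lattice ↔ x ∈ L.lattice ∨ x - w ∈ L.lattice) (hw : w ∉ L.lattice) :
    L'.G 4 = ℘[L] w ^ 2 - 4 * L.G 4 := by
  have h := (veluAux_eventuallyEq hΛ hw).iteratedDeriv_eq 2
  rw [iteratedDeriv_two_veluAux, iteratedDeriv_const_mul_field, iteratedDeriv_fun_pow_zero] at h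
  simp only [↓reduceIte, Nat.factorial, Nat.succ_eq_add_one, Nat.reduceAdd, zero_add, mul_one,
    Nat.cast_ofNat, g₂] at h
  linear_combination h / 6

/-- **Weight six invariant of the lattice of index two**: with the same hypotheses,
`5G₆(Λ') = 5G₆(Λ) + 3e³ - 15eG₄(Λ)` (equivalently `g₃(Λ') = g₃(Λ) + 84e³ − 7eg₂(Λ) = 56e³ + 8g₃(Λ)`
as `4e³ = g₂e + g₃`, Lawden (9.8.13), `g₃_of_indexTwo`).  Read off from the `z⁴`-coefficient of `S`.
[cite: Lawden1989, §9.8 eq. (9.8.13)] -/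
theorem G_six_of_indexTwo
    (hΛ : ∀ x, x ∈ L'.lattice ↔ x ∈ L.lattice ∨ x - w ∈ L.lattice) (hw : w ∉ L.lattice) :
    5 * L'.G 6 = 5 * L.G 6 + 3 * ℘[L] w ^ 3 - 15 * ℘[L] w * L.G 4 := by
  have h4 := G_four_of_indexTwo hΛ hw
  have h := (veluAux_eventuallyEq hΛ hw).iteratedDeriv_eq 4
  rw [iteratedDeriv_four_veluAux, iteratedDeriv_const_mul_field, iteratedDeriv_fun_pow_zero] at h
  simp only [show (4 : ℕ) ≠ 2 by decide, ↓reduceIte, Nat.cast_zero, mul_zero] at h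
  linear_combination h / 24 + 3 * ℘[L] w * h4

/-- `4e³ − g₂e − g₃ = 0`: `e = ℘(w)` is a root of `4x³ − g₂x − g₃` when `2w ∈ Λ`, `w ∉ Λ`
(`℘'(w) = 0` in `℘'² = 4℘³ − g₂℘ − g₃`; Lawden (6.7.19)/(6.7.26); cf.
`PeriodPair.derivWeierstrassP_eq_zero_of_two_mul_mem` in `RealLatticePeriodDiscrProofs.lean`, not imported
here to keep the import graph light). [folklore] -/
theorem cubic_weierstrassP_halfPeriod_eq_zero (hw : w ∉ L.lattice) (h2w : 2 * w ∈ L.lattice) :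
    4 * ℘[L] w ^ 3 - L.g₂ * ℘[L] w - L.g₃ = 0 := by
  have h0 : ℘'[L] w = 0 := by
    have := L.derivWeierstrassP_sub_coe w ⟨2 * w, h2w⟩
    rw [Subtype.coe_mk, show w - 2 * w = -w by ring, derivWeierstrassP_neg] at this
    have h2 : (2 : ℂ) * ℘'[L] w = 0 := by linear_combination -this
    simpa using h2
  have := L.derivWeierstrassP_sq w hw
  rw [h0] at this
  linear_combination -this

/-- **Lawden (9.8.12): `g₂` of the lattice of index two**, `g₂(Λ') = 60e² − 4g₂(Λ)`
(`e = ℘_Λ(w)`, `Λ' = Λ ∪ (w + Λ)`, `w ∉ Λ`). [cite: Lawden1989, §9.8 eq. (9.8.12)] -/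
theorem g₂_of_indexTwo
    (hΛ : ∀ x, x ∈ L'.lattice ↔ x ∈ L.lattice ∨ x - w ∈ L.lattice) (hw : w ∉ L.lattice) :
    L'.g₂ = 60 * ℘[L] w ^ 2 - 4 * L.g₂ := by
  simp only [g₂]
  linear_combination 60 * G_four_of_indexTwo hΛ hw

/-- **Lawden (9.8.13): `g₃` of the lattice of index two**, `g₃(Λ') = 56e³ + 8g₃(Λ)`
(`e = ℘_Λ(w)`, `Λ' = Λ ∪ (w + Λ)`, `w ∉ Λ`). [cite: Lawden1989, §9.8 eq. (9.8.13)] -/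
theorem g₃_of_indexTwo
    (hΛ : ∀ x, x ∈ L'.lattice ↔ x ∈ L.lattice ∨ x - w ∈ L.lattice) (hw : w ∉ L.lattice) :
    L'.g₃ = 56 * ℘[L] w ^ 3 + 8 * L.g₃ := by
  have hc := cubic_weierstrassP_halfPeriod_eq_zero hw (two_mul_w_mem_of_indexTwo hΛ hw)
  have h6 := G_six_of_indexTwo hΛ hw
  simp only [g₂, g₃] at hc ⊢
  linear_combination 28 * h6 + 7 * hc

end VeluTwoRelations

/-! ### Complex multiplication by an element of norm two -/

section CMTwo

variable {α : ℂ}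

/-- The lattice `α⁻¹Λ`: `x ∈ α⁻¹Λ ↔ αx ∈ Λ`. [folklore] -/
lemma mem_mulLeft_inv_lattice (hα : α ≠ 0) {x : ℂ} :
    x ∈ (L.mulLeft α⁻¹ (inv_ne_zero hα)).lattice ↔ α * x ∈ L.lattice := by
  rw [mem_mulLeft_lattice, inv_inv]

/-- `G_n(α⁻¹Λ) = αⁿ G_n(Λ)`. [folklore] -/
lemma G_mulLeft_inv (hα : α ≠ 0) (n : ℕ) :
    (L.mulLeft α⁻¹ (inv_ne_zero hα)).G n = α ^ n * L.G n := by
  rw [G_mulLeft, inv_pow, inv_inv]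

/-- **Complex multiplication of degree two** (the method of Stark, Cox §10.C, (10.21)–(10.22)):
if `αΛ ⊂ Λ` with `α⁻¹Λ = Λ ∪ (w + Λ)`, `w ∉ Λ` (so `[Λ : αΛ] = 2`), then with `e = ℘_Λ(w)`:
`e² = (α⁴ + 4) G₄(Λ)` — the weight-four invariant of `Λ ⊂ α⁻¹Λ` (`G_four_of_indexTwo`) together with
`G₄(α⁻¹Λ) = α⁴G₄(Λ)`. [cite: Cox2013, §10.C eqs. (10.21)–(10.22) (PDF pp. 223–224)] -/
theorem weierstrassP_sq_of_cmTwo (hα : α ≠ 0)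
    (hΛ : ∀ x, α * x ∈ L.lattice ↔ x ∈ L.lattice ∨ x - w ∈ L.lattice) (hw : w ∉ L.lattice) :
    ℘[L] w ^ 2 = (α ^ 4 + 4) * L.G 4 := by
  have hΛ' : ∀ x, x ∈ (L.mulLeft α⁻¹ (inv_ne_zero hα)).lattice ↔
      x ∈ L.lattice ∨ x - w ∈ L.lattice := fun x ↦ by rw [mem_mulLeft_inv_lattice hα, hΛ]
  have h4 := G_four_of_indexTwo hΛ' hw
  rw [G_mulLeft_inv hα] at h4
  linear_combination -h4

/-- **Complex multiplication of degree two, second relation**: with the same hypotheses,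
`5(α⁶ - 1) G₆(Λ) = 3(α⁴ - 1) e G₄(Λ)` — the weight-six invariant of `Λ ⊂ α⁻¹Λ` (`G_six_of_indexTwo`) with
`G₆(α⁻¹Λ) = α⁶G₆(Λ)` and the first relation. [cite: Cox2013, §10.C eqs. (10.21)–(10.22) (PDF pp. 223–224)] -/
theorem G_six_of_cmTwo (hα : α ≠ 0)
    (hΛ : ∀ x, α * x ∈ L.lattice ↔ x ∈ L.lattice ∨ x - w ∈ L.lattice) (hw : w ∉ L.lattice) :
    5 * (α ^ 6 - 1) * L.G 6 = 3 * (α ^ 4 - 1) * ℘[L] w * L.G 4 := by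
  have hΛ' : ∀ x, x ∈ (L.mulLeft α⁻¹ (inv_ne_zero hα)).lattice ↔
      x ∈ L.lattice ∨ x - w ∈ L.lattice := fun x ↦ by rw [mem_mulLeft_inv_lattice hα, hΛ]
  have h2 := weierstrassP_sq_of_cmTwo hα hΛ hw
  have h6 := G_six_of_indexTwo hΛ' hw
  rw [G_mulLeft_inv hα] at h6
  linear_combination h6 + 3 * ℘[L] w * h2

/-- **`j = 8000 = 20³` for a lattice with complex multiplication by `√−2`** (Cox §10.C,
"we will follow the exposition of Stark and show that `j(√−2) = 8000`"): if `α² = −2` and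
`α⁻¹Λ = Λ ∪ (w + Λ)`, `w ∉ Λ`, then `25G₆² = 8G₄³` (Cox: `g₂ = 20g`, `g₃ = 28g`, `g = 27/8`), whence
`j(Λ) = 1728g₂³/(g₂³ − 27g₃²) = 8000`.
[cite: Cox2013, §10.C eqs. (10.21)–(10.22) "j(√−2) = 8000" (PDF pp. 223–224) and §10.D Exercise 10.19] -/
theorem j_eq_of_cmTwo_of_sq_eq_neg_two (hα2 : α ^ 2 = -2)
    (hΛ : ∀ x, α * x ∈ L.lattice ↔ x ∈ L.lattice ∨ x - w ∈ L.lattice) (hw : w ∉ L.lattice) :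
    L.j = 8000 := by
  have hα : α ≠ 0 := by rintro rfl; norm_num at hα2
  have h4 : α ^ 4 = 4 := by rw [show α ^ 4 = (α ^ 2) ^ 2 by ring, hα2]; norm_num
  have h6 : α ^ 6 = -8 := by rw [show α ^ 6 = (α ^ 2) ^ 3 by ring, hα2]; norm_num
  have e2 := weierstrassP_sq_of_cmTwo hα hΛ hw
  have e1 := G_six_of_cmTwo hα hΛ hw
  rw [h4] at e2 e1
  rw [h6] at e1
  have e1' : ℘[L] w * L.G 4 = -5 * L.G 6 := by linear_combination e1 / (-9)
  have hrel : 8 * L.G 4 ^ 3 = 25 * L.G 6 ^ 2 := by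
    have : (℘[L] w * L.G 4) ^ 2 = (-5 * L.G 6) ^ 2 := by rw [e1']
    linear_combination this - L.G 4 ^ 2 * e2
  rw [j_def, div_eq_iff L.discr_ne_zero]
  simp only [g₂, g₃]
  linear_combination (-169344000) * hrel

/-- **`j = −3375 = (−15)³` for a lattice with complex multiplication by `(1 + √−7)/2`** (Cox
§10.C: "By a similar computation, one can also show that `j((1 + √−7)/2) = −3375`"; Exercise 10.20):
if `α² = α − 2` and `α⁻¹Λ = Λ ∪ (w + Λ)`, `w ∉ Λ`, then `175G₆² = 108G₄³`, whence `j(Λ) = −3375`.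
[cite: Cox2013, §10.C (PDF p. 224) and §10.D Exercise 10.20 (PDF p. 229)] -/
theorem j_eq_of_cmTwo_of_sq_eq_self_sub_two (hα2 : α ^ 2 = α - 2)
    (hΛ : ∀ x, α * x ∈ L.lattice ↔ x ∈ L.lattice ∨ x - w ∈ L.lattice) (hw : w ∉ L.lattice) :
    L.j = -3375 := by
  have hα : α ≠ 0 := by rintro rfl; norm_num at hα2
  have h4 : α ^ 4 = 2 - 3 * α := by
    linear_combination (α ^ 2 + α - 1) * hα2
  have h6 : α ^ 6 = 5 * α + 2 := by
    linear_combination (α ^ 4 + α ^ 3 - α ^ 2 - 3 * α - 1) * hα2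
  have e2 := weierstrassP_sq_of_cmTwo hα hΛ hw
  have e1 := G_six_of_cmTwo hα hΛ hw
  rw [h4] at e2 e1
  rw [h6] at e1
  have sq : 25 * (5 * α + 1) ^ 2 * L.G 6 ^ 2 = 9 * (1 - 3 * α) ^ 2 * (6 - 3 * α) * L.G 4 ^ 3 := by
    have : (5 * (5 * α + 2 - 1) * L.G 6) ^ 2 = (3 * (2 - 3 * α - 1) * ℘[L] w * L.G 4) ^ 2 := by
      rw [e1]
    linear_combination this + 9 * (1 - 3 * α) ^ 2 * L.G 4 ^ 2 * e2
  have key : (5 * α - 7) * (175 * L.G 6 ^ 2 - 108 * L.G 4 ^ 3) = 0 := by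
    linear_combination sq - 625 * L.G 6 ^ 2 * hα2 + (405 - 243 * α) * L.G 4 ^ 3 * hα2
  have h57 : 5 * α - 7 ≠ 0 := by
    intro h
    have hα' : α = 7 / 5 := by linear_combination h / 5
    rw [hα'] at hα2
    norm_num at hα2
  have hrel : 175 * L.G 6 ^ 2 - 108 * L.G 4 ^ 3 = 0 :=
    (mul_eq_zero.mp key).resolve_left h57
  rw [j_def, div_eq_iff L.discr_ne_zero]
  simp only [g₂, g₃]
  linear_combination (-10206000) * hrel

end CMTwo

/-! ### Lattices of index three: `Λ' = Λ ∪ (w + Λ) ∪ (−w + Λ)` -/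

section IndexThree

/-- `Λ ≤ Λ'` when `Λ' = Λ ∪ (w + Λ) ∪ (−w + Λ)`. [folklore] -/
lemma le_of_indexThree
    (hΛ : ∀ x, x ∈ L'.lattice ↔ x ∈ L.lattice ∨ x - w ∈ L.lattice ∨ x + w ∈ L.lattice) :
    L.lattice ≤ L'.lattice := fun x hx ↦ (hΛ x).mpr (Or.inl hx)

/-- `w ∈ Λ'` when `Λ' = Λ ∪ (w + Λ) ∪ (−w + Λ)`. [folklore] -/
lemma w_mem_of_indexThree
    (hΛ : ∀ x, x ∈ L'.lattice ↔ x ∈ L.lattice ∨ x - w ∈ L.lattice ∨ x + w ∈ L.lattice) :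
    w ∈ L'.lattice := (hΛ w).mpr (Or.inr (Or.inl (by simp)))

/-- `3w ∈ Λ` when `Λ' = Λ ∪ (w + Λ) ∪ (−w + Λ)`, `w, 2w ∉ Λ`. [folklore] -/
lemma three_mul_w_mem_of_indexThree
    (hΛ : ∀ x, x ∈ L'.lattice ↔ x ∈ L.lattice ∨ x - w ∈ L.lattice ∨ x + w ∈ L.lattice)
    (hw : w ∉ L.lattice) (h2w : 2 * w ∉ L.lattice) : 3 * w ∈ L.lattice := by
  have h2 : 2 * w ∈ L'.lattice := by
    rw [two_mul]; exact add_mem (w_mem_of_indexThree hΛ) (w_mem_of_indexThree hΛ)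
  rcases (hΛ _).mp h2 with h | h | h
  · exact absurd h h2w
  · rw [show 2 * w - w = w by ring] at h
    exact absurd h hw
  · rwa [show 2 * w + w = 3 * w by ring] at h

/-- `℘(2w) = ℘(w)` when `3w ∈ Λ` (`2w ≡ −w`). [folklore] -/
lemma weierstrassP_two_mul_of_three_mul_mem (h3w : 3 * w ∈ L.lattice) :
    ℘[L] (2 * w) = ℘[L] w := by
  have := L.weierstrassP_sub_coe (2 * w) ⟨3 * w, h3w⟩
  rw [Subtype.coe_mk, show 2 * w - 3 * w = -w by ring, L.weierstrassP_neg] at this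
  exact this.symm

/-- If `z ∉ Λ'` then `z ∉ Λ` (index three). [folklore] -/
lemma notMem_of_notMem_of_indexThree
    (hΛ : ∀ x, x ∈ L'.lattice ↔ x ∈ L.lattice ∨ x - w ∈ L.lattice ∨ x + w ∈ L.lattice) {z : ℂ}
    (hz : z ∉ L'.lattice) : z ∉ L.lattice := fun h ↦ hz (le_of_indexThree hΛ h)

/-- If `z ∉ Λ'` then `z - w ∉ Λ` (index three). [folklore] -/
lemma sub_notMem_of_notMem_of_indexThree
    (hΛ : ∀ x, x ∈ L'.lattice ↔ x ∈ L.lattice ∨ x - w ∈ L.lattice ∨ x + w ∈ L.lattice) {z : ℂ}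
    (hz : z ∉ L'.lattice) : z - w ∉ L.lattice := fun h ↦ hz ((hΛ z).mpr (Or.inr (Or.inl h)))

/-- If `z ∉ Λ'` then `z + w ∉ Λ` (index three). [folklore] -/
lemma add_notMem_of_notMem_of_indexThree
    (hΛ : ∀ x, x ∈ L'.lattice ↔ x ∈ L.lattice ∨ x - w ∈ L.lattice ∨ x + w ∈ L.lattice) {z : ℂ}
    (hz : z ∉ L'.lattice) : z + w ∉ L.lattice := fun h ↦ hz ((hΛ z).mpr (Or.inr (Or.inr h)))

/-- The auxiliary function of the Liouville argument for the index-three formula: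
`℘_{Λ'}(z) - ℘_Λ(z) - ℘_Λ(z - w) - ℘_Λ(z + w)` off `Λ'`, extended by `-2℘_Λ(w)` on `Λ'`.
[folklore] -/
def indexThreeAux (L L' : PeriodPair) (w : ℂ) (z : ℂ) : ℂ :=
  letI := Classical.propDecidable
  if z ∈ L'.lattice then -2 * ℘[L] w else ℘[L'] z - ℘[L] z - ℘[L] (z - w) - ℘[L] (z + w)

/-- Value of the auxiliary function on `Λ'`. [folklore] -/
lemma indexThreeAux_of_mem {z : ℂ} (hz : z ∈ L'.lattice) :
    indexThreeAux L L' w z = -2 * ℘[L] w := by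
  classical simp [indexThreeAux, hz]

/-- Value of the auxiliary function off `Λ'`. [folklore] -/
lemma indexThreeAux_of_notMem {z : ℂ} (hz : z ∉ L'.lattice) :
    indexThreeAux L L' w z = ℘[L'] z - ℘[L] z - ℘[L] (z - w) - ℘[L] (z + w) := by
  classical simp [indexThreeAux, hz]

/-- `Λ`-periodicity of the auxiliary function. [folklore] -/
lemma indexThreeAux_add_coe
    (hΛ : ∀ x, x ∈ L'.lattice ↔ x ∈ L.lattice ∨ x - w ∈ L.lattice ∨ x + w ∈ L.lattice)
    (z : ℂ) (l : L.lattice) : indexThreeAux L L' w (z + l) = indexThreeAux L L' w z := by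
  have hl' : (l : ℂ) ∈ L'.lattice := le_of_indexThree hΛ l.2
  by_cases hz : z ∈ L'.lattice
  · rw [indexThreeAux_of_mem hz, indexThreeAux_of_mem (add_mem hz hl')]
  · have hz' : z + l ∉ L'.lattice := fun h ↦ hz (by simpa using sub_mem h hl')
    rw [indexThreeAux_of_notMem hz, indexThreeAux_of_notMem hz',
      show z + l - w = (z - w) + l by ring, show z + l + w = (z + w) + l by ring,
      L.weierstrassP_add_coe, L.weierstrassP_add_coe, L.weierstrassP_add_coe,
      ← Subtype.coe_mk (l : ℂ) hl', L'.weierstrassP_add_coe]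

/-- `Λ`-periodicity of the auxiliary function (subtractive form). [folklore] -/
lemma indexThreeAux_sub_coe
    (hΛ : ∀ x, x ∈ L'.lattice ↔ x ∈ L.lattice ∨ x - w ∈ L.lattice ∨ x + w ∈ L.lattice)
    (z : ℂ) (l : L.lattice) : indexThreeAux L L' w (z - l) = indexThreeAux L L' w z := by
  rw [← indexThreeAux_add_coe hΛ (z - l) l, sub_add_cancel]

/-- Analyticity of the auxiliary function at `0`. [folklore] -/
lemma analyticAt_indexThreeAux_zero (L' : PeriodPair) (hw : w ∉ L.lattice) :
    AnalyticAt ℂ (indexThreeAux L L' w) 0 := by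
  have hw' : 0 - w ∉ L.lattice := fun h ↦ hw (by simpa using neg_mem h)
  have hw'' : 0 - (-w) ∉ L.lattice := by simpa using hw
  have hg : AnalyticAt ℂ
      (fun z ↦ ℘[L' - (0 : ℂ)] z - ℘[L - (0 : ℂ)] z - ℘[L] (z - w) - ℘[L] (z - (-w))) 0 :=
    (((L'.analyticAt_weierstrassPExcept 0).sub (L.analyticAt_weierstrassPExcept 0)).sub
      (L.analyticAt_weierstrassP_sub_const w hw')).sub (L.analyticAt_weierstrassP_sub_const (-w) hw'')
  refine hg.congr ?_
  filter_upwards [L'.compl_lattice_sdiff_singleton_mem_nhds 0] with z hz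
  by_cases hz0 : z = 0
  · rw [hz0, indexThreeAux_of_mem (zero_mem _)]
    simp
    ring
  · have hzΛ' : z ∉ L'.lattice := fun h ↦ hz ⟨h, hz0⟩
    rw [indexThreeAux_of_notMem hzΛ', L'.weierstrassP_eq_weierstrassPExcept_add z,
      L.weierstrassP_eq_weierstrassPExcept_add z, sub_neg_eq_add]
    ring

/-- Analyticity of the auxiliary function at `w`. [folklore] -/
lemma analyticAt_indexThreeAux_w
    (hΛ : ∀ x, x ∈ L'.lattice ↔ x ∈ L.lattice ∨ x - w ∈ L.lattice ∨ x + w ∈ L.lattice)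
    (hw : w ∉ L.lattice) (h2w : 2 * w ∉ L.lattice) :
    AnalyticAt ℂ (indexThreeAux L L' w) w := by
  have hwΛ' : w ∈ L'.lattice := w_mem_of_indexThree hΛ
  have h3w := three_mul_w_mem_of_indexThree hΛ hw h2w
  have h2w' : w - (-w) ∉ L.lattice := by rwa [sub_neg_eq_add, ← two_mul]
  have hg : AnalyticAt ℂ
      (fun z ↦ ℘[L' - w] z - 1 / w ^ 2 - ℘[L] z - ℘[L - (0 : ℂ)] (z - w) - ℘[L] (z - (-w))) w :=
    ((((L'.analyticAt_weierstrassPExcept w).sub analyticAt_const).sub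
      (L.analyticOnNhd_weierstrassP w hw)).sub (L.analyticAt_weierstrassPExcept_sub_const w)).sub
      (L.analyticAt_weierstrassP_sub_const (-w) h2w')
  refine hg.congr ?_
  filter_upwards [L'.compl_lattice_sdiff_singleton_mem_nhds w] with z hz
  have hdef : ∀ z, ℘[L' - w] z = ℘[L'] z + (1 / w ^ 2 - 1 / (z - w) ^ 2) := fun z ↦
    L'.weierstrassPExcept_def ⟨w, hwΛ'⟩ z
  by_cases hzw : z = w
  · rw [hzw, indexThreeAux_of_mem hwΛ', hdef, sub_self, L.weierstrassPExcept_zero,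
      show ℘[L'] w = 0 from L'.weierstrassP_coe ⟨w, hwΛ'⟩, sub_neg_eq_add, ← two_mul,
      weierstrassP_two_mul_of_three_mul_mem h3w]
    simp
    ring
  · have hzΛ' : z ∉ L'.lattice := fun h ↦ hz ⟨h, hzw⟩
    rw [indexThreeAux_of_notMem hzΛ', hdef, L.weierstrassP_eq_weierstrassPExcept_add (z - w),
      sub_neg_eq_add]
    ring

/-- Analyticity of the auxiliary function at `-w`. [folklore] -/
lemma analyticAt_indexThreeAux_neg_w
    (hΛ : ∀ x, x ∈ L'.lattice ↔ x ∈ L.lattice ∨ x - w ∈ L.lattice ∨ x + w ∈ L.lattice)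
    (hw : w ∉ L.lattice) (h2w : 2 * w ∉ L.lattice) :
    AnalyticAt ℂ (indexThreeAux L L' w) (-w) := by
  have hwΛ' : -w ∈ L'.lattice := neg_mem (w_mem_of_indexThree hΛ)
  have hw' : -w ∉ L.lattice := fun h ↦ hw (by simpa using neg_mem h)
  have h3w := three_mul_w_mem_of_indexThree hΛ hw h2w
  have h2w' : -w - w ∉ L.lattice := by
    rw [show -w - w = -(2 * w) by ring]; exact fun h ↦ h2w (by simpa using neg_mem h)
  have hg : AnalyticAt ℂ
      (fun z ↦ ℘[L' - (-w)] z - 1 / w ^ 2 - ℘[L] z - ℘[L] (z - w) - ℘[L - (0 : ℂ)] (z - (-w)))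
      (-w) :=
    ((((L'.analyticAt_weierstrassPExcept (-w)).sub analyticAt_const).sub
      (L.analyticOnNhd_weierstrassP (-w) hw')).sub (L.analyticAt_weierstrassP_sub_const w h2w')).sub
      (L.analyticAt_weierstrassPExcept_sub_const (-w))
  refine hg.congr ?_
  filter_upwards [L'.compl_lattice_sdiff_singleton_mem_nhds (-w)] with z hz
  have hdef : ∀ z, ℘[L' - (-w)] z = ℘[L'] z + (1 / (-w) ^ 2 - 1 / (z - (-w)) ^ 2) := fun z ↦
    L'.weierstrassPExcept_def ⟨-w, hwΛ'⟩ z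
  by_cases hzw : z = -w
  · rw [hzw, indexThreeAux_of_mem hwΛ', hdef, sub_self, L.weierstrassPExcept_zero,
      show ℘[L'] (-w) = 0 from L'.weierstrassP_coe ⟨-w, hwΛ'⟩, L.weierstrassP_neg,
      show -w - w = -(2 * w) by ring, L.weierstrassP_neg, weierstrassP_two_mul_of_three_mul_mem h3w]
    simp
    ring
  · have hzΛ' : z ∉ L'.lattice := fun h ↦ hz ⟨h, hzw⟩
    rw [indexThreeAux_of_notMem hzΛ', hdef, sub_neg_eq_add,
      L.weierstrassP_eq_weierstrassPExcept_add (z + w)]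
    ring

/-- The auxiliary function is entire (index three). [folklore] -/
lemma analyticAt_indexThreeAux
    (hΛ : ∀ x, x ∈ L'.lattice ↔ x ∈ L.lattice ∨ x - w ∈ L.lattice ∨ x + w ∈ L.lattice)
    (hw : w ∉ L.lattice) (h2w : 2 * w ∉ L.lattice) (x : ℂ) :
    AnalyticAt ℂ (indexThreeAux L L' w) x := by
  by_cases hx : x ∈ L'.lattice
  · have key : ∀ (l : L.lattice) (y : ℂ), AnalyticAt ℂ (indexThreeAux L L' w) y →
        AnalyticAt ℂ (indexThreeAux L L' w) (y + l) := by
      intro l y hy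
      have ht : AnalyticAt ℂ (fun z : ℂ ↦ z - l) (y + l) := by fun_prop
      have := hy.comp_of_eq ht (by simp)
      rw [Function.comp_def] at this
      simpa only [indexThreeAux_sub_coe hΛ] using this
    rcases (hΛ x).mp hx with h | h | h
    · have := key ⟨x, h⟩ 0 (analyticAt_indexThreeAux_zero L' hw)
      simpa using this
    · have := key ⟨x - w, h⟩ w (analyticAt_indexThreeAux_w hΛ hw h2w)
      simpa using this
    · have := key ⟨x + w, h⟩ (-w) (analyticAt_indexThreeAux_neg_w hΛ hw h2w)
      simpa using this
  · have hxΛ : x ∉ L.lattice := notMem_of_notMem_of_indexThree hΛ hx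
    have hxw : x - w ∉ L.lattice := sub_notMem_of_notMem_of_indexThree hΛ hx
    have hxw' : x - (-w) ∉ L.lattice := by
      rw [sub_neg_eq_add]; exact add_notMem_of_notMem_of_indexThree hΛ hx
    have hg : AnalyticAt ℂ (fun z ↦ ℘[L'] z - ℘[L] z - ℘[L] (z - w) - ℘[L] (z - (-w))) x :=
      (((L'.analyticOnNhd_weierstrassP x hx).sub (L.analyticOnNhd_weierstrassP x hxΛ)).sub
        (L.analyticAt_weierstrassP_sub_const w hxw)).sub
        (L.analyticAt_weierstrassP_sub_const (-w) hxw')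
    refine hg.congr ?_
    filter_upwards [L'.isClosed_lattice.isOpen_compl.mem_nhds hx] with z hz
    rw [indexThreeAux_of_notMem hz, sub_neg_eq_add]

/-- The auxiliary function is constant (Liouville; index three). [folklore] -/
lemma indexThreeAux_eq
    (hΛ : ∀ x, x ∈ L'.lattice ↔ x ∈ L.lattice ∨ x - w ∈ L.lattice ∨ x + w ∈ L.lattice)
    (hw : w ∉ L.lattice) (h2w : 2 * w ∉ L.lattice) (z : ℂ) :
    indexThreeAux L L' w z = -2 * ℘[L] w := by
  have hd : Differentiable ℂ (indexThreeAux L L' w) := fun x ↦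
    (analyticAt_indexThreeAux hΛ hw h2w x).differentiableAt
  have := hd.apply_eq_apply_of_bounded (IsZLattice.isCompact_range_of_periodic L.lattice _
    hd.continuous fun z l hl ↦ by
      lift l to L.lattice using hl; exact indexThreeAux_add_coe hΛ z l).isBounded z 0
  rw [this, indexThreeAux_of_mem (zero_mem _)]

/-- **`℘` of a lattice of index three** (third-order transformation of `℘`).  If
`Λ ⊂ Λ' = Λ ∪ (w + Λ) ∪ (−w + Λ)` with `w, 2w ∉ Λ` (so `3w ∈ Λ`), then for `z ∉ Λ'`,
`℘_{Λ'}(z) = ℘_Λ(z) + ℘_Λ(z − w) + ℘_Λ(z + w) − 2℘_Λ(w)` — the case `n = 3` of Lawden §9.8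
(cf. (9.8.14): `℘(u | 3ω₁, ω₃) = (1/9){℘(u/3) + ℘(u/3 + 2ω₃/3) + ℘(u/3 − 2ω₃/3) − 2℘(2ω₃/3)}`, the
homothetic form), by Liouville's theorem as for (9.8.6). [cite: Lawden1989, §9.8 eq. (9.8.14)] -/
theorem weierstrassP_of_indexThree
    (hΛ : ∀ x, x ∈ L'.lattice ↔ x ∈ L.lattice ∨ x - w ∈ L.lattice ∨ x + w ∈ L.lattice)
    (hw : w ∉ L.lattice) (h2w : 2 * w ∉ L.lattice) {z : ℂ} (hz : z ∉ L'.lattice) :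
    ℘[L'] z = ℘[L] z + ℘[L] (z - w) + ℘[L] (z + w) - 2 * ℘[L] w := by
  have := indexThreeAux_eq hΛ hw h2w z
  rw [indexThreeAux_of_notMem hz] at this
  linear_combination this

end IndexThree

/-! ### `℘(z + w) + ℘(z − w)` -/

section AddSub

/-- The rational-function identity behind `℘(z + w) + ℘(z − w)`. [folklore] -/
lemma addSub_identity {X Y E F G₂ G₃ : ℂ} (h : X - E ≠ 0) :
    ((Y - F) / (X - E)) ^ 2 / 4 - X - E + (((Y + F) / (X - E)) ^ 2 / 4 - X - E) -
      (2 * E * X ^ 2 + (2 * E ^ 2 - G₂ / 2) * X - (G₂ * E / 2 + G₃)) / (X - E) ^ 2 =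
      (Y ^ 2 - (4 * X ^ 3 - G₂ * X - G₃) + (F ^ 2 - (4 * E ^ 3 - G₂ * E - G₃))) /
        (2 * (X - E) ^ 2) := by
  field_simp
  ring

/-- **`℘(z + w) + ℘(z − w) = (2e℘(z)² + (2e² − g₂/2)℘(z) − (g₂e/2 + g₃))/(℘(z) − e)²`**
(`e = ℘(w)`), for `z, w, z ± w ∉ Λ`: add the addition theorem (Lawden (6.8.10),
`PeriodPair.weierstrassP_add_holds`) for `(z, w)` and `(z, −w)` and use `℘'² = 4℘³ − g₂℘ − g₃` at
`z` and `w`. [folklore] -/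
theorem weierstrassP_add_add_weierstrassP_sub {z : ℂ} (hz : z ∉ L.lattice) (hw : w ∉ L.lattice)
    (hzw : z - w ∉ L.lattice) (hzw' : z + w ∉ L.lattice) :
    ℘[L] (z + w) + ℘[L] (z - w) =
      (2 * ℘[L] w * ℘[L] z ^ 2 + (2 * ℘[L] w ^ 2 - L.g₂ / 2) * ℘[L] z
        - (L.g₂ * ℘[L] w / 2 + L.g₃)) / (℘[L] z - ℘[L] w) ^ 2 := by
  have hw' : -w ∉ L.lattice := fun h ↦ hw (by simpa using neg_mem h)
  have hne : ℘[L] z ≠ ℘[L] w := fun h ↦ by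
    rcases (L.weierstrassP_eq_weierstrassP_iff hz hw).mp h with h' | h'
    · exact hzw' h'
    · exact hzw h'
  have hne' : ℘[L] z ≠ ℘[L] (-w) := by rwa [L.weierstrassP_neg]
  have hadd := L.weierstrassP_add_holds z w hz hw hne
  have hsub := L.weierstrassP_add_holds z (-w) hz hw' hne'
  rw [L.weierstrassP_neg, L.derivWeierstrassP_neg, sub_neg_eq_add, ← sub_eq_add_neg] at hsub
  have hsq := L.derivWeierstrassP_sq z hz
  have hsqw := L.derivWeierstrassP_sq w hw
  have hD : ℘[L] z - ℘[L] w ≠ 0 := sub_ne_zero.mpr hne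
  have key := addSub_identity (Y := ℘'[L] z) (F := ℘'[L] w) (G₂ := L.g₂) (G₃ := L.g₃) hD
  rw [hsq, hsqw, ← hadd, ← hsub, sub_self, sub_self, zero_add, zero_div] at key
  exact sub_eq_zero.mp key

end AddSub

/-! ### The invariants of a lattice of index three -/

section VeluThree

/-- Off `Λ'`, `(℘_{Λ'} − ℘_Λ)(℘_Λ − e)² = (6e² − g₂/2)℘_Λ − (2e³ + g₂e/2 + g₃)` (`e = ℘_Λ(w)`):
the index-three formula combined with `weierstrassP_add_add_weierstrassP_sub`. [folklore] -/
theorem weierstrassP_sub_mul_sub_sq_of_indexThree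
    (hΛ : ∀ x, x ∈ L'.lattice ↔ x ∈ L.lattice ∨ x - w ∈ L.lattice ∨ x + w ∈ L.lattice)
    (hw : w ∉ L.lattice) (h2w : 2 * w ∉ L.lattice) {z : ℂ} (hz : z ∉ L'.lattice) :
    (℘[L'] z - ℘[L] z) * (℘[L] z - ℘[L] w) ^ 2 =
      (6 * ℘[L] w ^ 2 - L.g₂ / 2) * ℘[L] z - (2 * ℘[L] w ^ 3 + L.g₂ * ℘[L] w / 2 + L.g₃) := by
  have hzΛ := notMem_of_notMem_of_indexThree hΛ hz
  have hzw := sub_notMem_of_notMem_of_indexThree hΛ hz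
  have hzw' := add_notMem_of_notMem_of_indexThree hΛ hz
  have hne : ℘[L] z ≠ ℘[L] w := fun h ↦ by
    rcases (L.weierstrassP_eq_weierstrassP_iff hzΛ hw).mp h with h' | h'
    · exact hzw' h'
    · exact hzw h'
  have hD : ℘[L] z - ℘[L] w ≠ 0 := sub_ne_zero.mpr hne
  have h1 := weierstrassP_of_indexThree hΛ hw h2w hz
  have h2 := weierstrassP_add_add_weierstrassP_sub hzΛ hw hzw hzw'
  rw [show ℘[L'] z - ℘[L] z = ℘[L] (z + w) + ℘[L] (z - w) - 2 * ℘[L] w by rw [h1]; ring, h2]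
  field_simp
  ring

/-- The analytic germ at `0` for index three:
`S₃(z) = (℘⁻_{Λ'}(z) − ℘⁻_Λ(z)) · (z²℘⁻_Λ(z) + 1 − ez²)²`. [folklore] -/
def veluThreeAux (L L' : PeriodPair) (e : ℂ) (z : ℂ) : ℂ :=
  (℘[L' - (0 : ℂ)] z - ℘[L - (0 : ℂ)] z) *
    ((z ^ 2 * ℘[L - (0 : ℂ)] z + 1 - e * z ^ 2) * (z ^ 2 * ℘[L - (0 : ℂ)] z + 1 - e * z ^ 2))

/-- The right-hand germ `R₃(z) = (6e² − g₂/2)(z⁴℘⁻_Λ(z) + z²) − (2e³ + g₂e/2 + g₃)z⁴`. [folklore] -/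
def veluThreeRhs (L : PeriodPair) (e : ℂ) (z : ℂ) : ℂ :=
  (6 * e ^ 2 - L.g₂ / 2) * (z ^ 4 * ℘[L - (0 : ℂ)] z + z ^ 2) - (2 * e ^ 3 + L.g₂ * e / 2 + L.g₃) * z ^ 4

/-- `S₃` is analytic at `0`. [folklore] -/
lemma analyticAt_veluThreeAux (L L' : PeriodPair) (e : ℂ) :
    AnalyticAt ℂ (veluThreeAux L L' e) 0 := by
  unfold veluThreeAux
  fun_prop

/-- `R₃` is analytic at `0`. [folklore] -/
lemma analyticAt_veluThreeRhs (L : PeriodPair) (e : ℂ) : AnalyticAt ℂ (veluThreeRhs L e) 0 := by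
  unfold veluThreeRhs
  fun_prop

/-- Off `0` near `0`, `S₃ = R₃` (index three, `e = ℘_Λ(w)`). [folklore] -/
lemma veluThreeAux_eq_of_notMem
    (hΛ : ∀ x, x ∈ L'.lattice ↔ x ∈ L.lattice ∨ x - w ∈ L.lattice ∨ x + w ∈ L.lattice)
    (hw : w ∉ L.lattice) (h2w : 2 * w ∉ L.lattice) {z : ℂ} (hz : z ∉ L'.lattice) :
    veluThreeAux L L' (℘[L] w) z = veluThreeRhs L (℘[L] w) z := by
  have hz0 : z ≠ 0 := fun h ↦ hz (h ▸ zero_mem _)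
  have key := weierstrassP_sub_mul_sub_sq_of_indexThree hΛ hw h2w hz
  rw [L'.weierstrassP_eq_weierstrassPExcept_add z, L.weierstrassP_eq_weierstrassPExcept_add z]
    at key
  have : veluThreeAux L L' (℘[L] w) z =
      z ^ 4 * ((℘[L' - (0 : ℂ)] z + 1 / z ^ 2 - (℘[L - (0 : ℂ)] z + 1 / z ^ 2)) *
        (℘[L - (0 : ℂ)] z + 1 / z ^ 2 - ℘[L] w) ^ 2) := by
    unfold veluThreeAux
    field_simp
    ring
  rw [this, key, veluThreeRhs]
  field_simp

/-- Near `0` (including `0`), `S₃ = R₃` (isolated zeros). [folklore] -/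
lemma veluThreeAux_eventuallyEq
    (hΛ : ∀ x, x ∈ L'.lattice ↔ x ∈ L.lattice ∨ x - w ∈ L.lattice ∨ x + w ∈ L.lattice)
    (hw : w ∉ L.lattice) (h2w : 2 * w ∉ L.lattice) :
    veluThreeAux L L' (℘[L] w) =ᶠ[𝓝 0] veluThreeRhs L (℘[L] w) := by
  have hT : AnalyticAt ℂ (fun z ↦ veluThreeAux L L' (℘[L] w) z - veluThreeRhs L (℘[L] w) z) 0 :=
    (analyticAt_veluThreeAux L L' _).sub (analyticAt_veluThreeRhs L _)
  have hpunct : ∀ᶠ z in 𝓝[≠] (0 : ℂ),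
      veluThreeAux L L' (℘[L] w) z - veluThreeRhs L (℘[L] w) z = 0 := by
    filter_upwards [self_mem_nhdsWithin,
      mem_nhdsWithin_of_mem_nhds (L'.compl_lattice_sdiff_singleton_mem_nhds 0)] with z hz0 hz
    have hzΛ' : z ∉ L'.lattice := fun h ↦ hz ⟨h, hz0⟩
    rw [veluThreeAux_eq_of_notMem hΛ hw h2w hzΛ', sub_self]
  rcases hT.eventually_eq_zero_or_eventually_ne_zero with h | h
  · filter_upwards [h] with z hz
    simpa [sub_eq_zero] using hz
  · exact absurd (h.and hpunct).exists (by simp)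

attribute [local fun_prop] AnalyticAt.contDiffAt in
/-- `S₃''(0) = 6(G₄(Λ') − G₄(Λ))`. [folklore] -/
lemma iteratedDeriv_two_veluThreeAux (L L' : PeriodPair) (e : ℂ) :
    iteratedDeriv 2 (veluThreeAux L L' e) 0 = 6 * (L'.G 4 - L.G 4) := by
  unfold veluThreeAux
  simp (discharger := fun_prop) only [iteratedDeriv_fun_add, iteratedDeriv_fun_sub,
    iteratedDeriv_fun_mul, iteratedDeriv_const, iteratedDeriv_fun_pow_zero,
    iteratedDeriv_weierstrassPExcept_self]
  simp [Finset.sum_range_succ, L.G_eq_zero_of_odd 3 (by decide), L'.G_eq_zero_of_odd 3 (by decide),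
    Nat.factorial]
  ring

attribute [local fun_prop] AnalyticAt.contDiffAt in
/-- `S₃⁗(0) = 120(G₆(Λ') − G₆(Λ)) − 144e(G₄(Λ') − G₄(Λ))`. [folklore] -/
lemma iteratedDeriv_four_veluThreeAux (L L' : PeriodPair) (e : ℂ) :
    iteratedDeriv 4 (veluThreeAux L L' e) 0 =
      120 * (L'.G 6 - L.G 6) - 144 * e * (L'.G 4 - L.G 4) := by
  unfold veluThreeAux
  simp (discharger := fun_prop) only [iteratedDeriv_fun_add, iteratedDeriv_fun_sub,
    iteratedDeriv_fun_mul, iteratedDeriv_const, iteratedDeriv_fun_pow_zero,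
    iteratedDeriv_weierstrassPExcept_self]
  simp [Finset.sum_range_succ, L.G_eq_zero_of_odd 3 (by decide), L'.G_eq_zero_of_odd 3 (by decide),
    L.G_eq_zero_of_odd 5 (by decide), L'.G_eq_zero_of_odd 5 (by decide), Nat.factorial,
    show Nat.choose 4 2 = 6 by rfl]
  ring

attribute [local fun_prop] AnalyticAt.contDiffAt in
/-- `R₃''(0) = 2(6e² − g₂/2)`. [folklore] -/
lemma iteratedDeriv_two_veluThreeRhs (L : PeriodPair) (e : ℂ) :
    iteratedDeriv 2 (veluThreeRhs L e) 0 = 2 * (6 * e ^ 2 - L.g₂ / 2) := by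
  unfold veluThreeRhs
  simp (discharger := fun_prop) only [iteratedDeriv_fun_add, iteratedDeriv_fun_sub,
    iteratedDeriv_fun_mul, iteratedDeriv_const, iteratedDeriv_fun_pow_zero,
    iteratedDeriv_weierstrassPExcept_self]
  simp [Finset.sum_range_succ, Nat.factorial]
  ring

attribute [local fun_prop] AnalyticAt.contDiffAt in
/-- `R₃⁗(0) = −24(2e³ + g₂e/2 + g₃)`. [folklore] -/
lemma iteratedDeriv_four_veluThreeRhs (L : PeriodPair) (e : ℂ) :
    iteratedDeriv 4 (veluThreeRhs L e) 0 = -24 * (2 * e ^ 3 + L.g₂ * e / 2 + L.g₃) := by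
  unfold veluThreeRhs
  simp (discharger := fun_prop) only [iteratedDeriv_fun_add, iteratedDeriv_fun_sub,
    iteratedDeriv_fun_mul, iteratedDeriv_const, iteratedDeriv_fun_pow_zero,
    iteratedDeriv_weierstrassPExcept_self]
  simp [Finset.sum_range_succ, Nat.factorial, show Nat.choose 4 2 = 6 by rfl]
  ring

/-- **Weight four invariant of the lattice of index three**: `G₄(Λ') = 2e² − 9G₄(Λ)`
(`e = ℘_Λ(w)`), i.e. `g₂(Λ') = 120e² − 9g₂(Λ)`. [folklore] -/
theorem G_four_of_indexThree
    (hΛ : ∀ x, x ∈ L'.lattice ↔ x ∈ L.lattice ∨ x - w ∈ L.lattice ∨ x + w ∈ L.lattice)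
    (hw : w ∉ L.lattice) (h2w : 2 * w ∉ L.lattice) :
    L'.G 4 = 2 * ℘[L] w ^ 2 - 9 * L.G 4 := by
  have h := (veluThreeAux_eventuallyEq hΛ hw h2w).iteratedDeriv_eq 2
  rw [iteratedDeriv_two_veluThreeAux, iteratedDeriv_two_veluThreeRhs] at h
  simp only [g₂] at h
  linear_combination h / 6

/-- **Weight six invariant of the lattice of index three**:
`G₆(Λ') = 2e³ − 18eG₄(Λ) − 27G₆(Λ)` (`e = ℘_Λ(w)`). [folklore] -/
theorem G_six_of_indexThree
    (hΛ : ∀ x, x ∈ L'.lattice ↔ x ∈ L.lattice ∨ x - w ∈ L.lattice ∨ x + w ∈ L.lattice)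
    (hw : w ∉ L.lattice) (h2w : 2 * w ∉ L.lattice) :
    L'.G 6 = 2 * ℘[L] w ^ 3 - 18 * ℘[L] w * L.G 4 - 27 * L.G 6 := by
  have h4 := G_four_of_indexThree hΛ hw h2w
  have h := (veluThreeAux_eventuallyEq hΛ hw h2w).iteratedDeriv_eq 4
  rw [iteratedDeriv_four_veluThreeAux, iteratedDeriv_four_veluThreeRhs] at h
  simp only [g₂, g₃] at h
  linear_combination h / 120 + 6 / 5 * ℘[L] w * h4

end VeluThree

/-! ### Complex multiplication by an element of norm three -/

section CMThree

variable {α : ℂ}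

/-- **Complex multiplication of degree three, first relation**: if `α⁻¹Λ = Λ ∪ (w + Λ) ∪ (−w + Λ)`,
`w, 2w ∉ Λ` (`αΛ ⊂ Λ` of index `3`), then with `e = ℘_Λ(w)`: `2e² = (α⁴ + 9)G₄(Λ)` (the method of
Cox §10.C (10.21)–(10.22) for an element of norm `3`). [folklore] -/
theorem weierstrassP_sq_of_cmThree (hα : α ≠ 0)
    (hΛ : ∀ x, α * x ∈ L.lattice ↔ x ∈ L.lattice ∨ x - w ∈ L.lattice ∨ x + w ∈ L.lattice)
    (hw : w ∉ L.lattice) (h2w : 2 * w ∉ L.lattice) :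
    2 * ℘[L] w ^ 2 = (α ^ 4 + 9) * L.G 4 := by
  have hΛ' : ∀ x, x ∈ (L.mulLeft α⁻¹ (inv_ne_zero hα)).lattice ↔
      x ∈ L.lattice ∨ x - w ∈ L.lattice ∨ x + w ∈ L.lattice := fun x ↦ by
    rw [mem_mulLeft_inv_lattice hα, hΛ]
  have h4 := G_four_of_indexThree hΛ' hw h2w
  rw [G_mulLeft_inv hα] at h4
  linear_combination -h4

/-- **Complex multiplication of degree three, second relation**: with the same hypotheses,
`(α⁶ + 27)G₆(Λ) = (α⁴ − 9)eG₄(Λ)`. [folklore] -/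
theorem G_six_of_cmThree (hα : α ≠ 0)
    (hΛ : ∀ x, α * x ∈ L.lattice ↔ x ∈ L.lattice ∨ x - w ∈ L.lattice ∨ x + w ∈ L.lattice)
    (hw : w ∉ L.lattice) (h2w : 2 * w ∉ L.lattice) :
    (α ^ 6 + 27) * L.G 6 = (α ^ 4 - 9) * ℘[L] w * L.G 4 := by
  have hΛ' : ∀ x, x ∈ (L.mulLeft α⁻¹ (inv_ne_zero hα)).lattice ↔
      x ∈ L.lattice ∨ x - w ∈ L.lattice ∨ x + w ∈ L.lattice := fun x ↦ by
    rw [mem_mulLeft_inv_lattice hα, hΛ]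
  have h2 := weierstrassP_sq_of_cmThree hα hΛ hw h2w
  have h6 := G_six_of_indexThree hΛ' hw h2w
  rw [G_mulLeft_inv hα] at h6
  linear_combination h6 + ℘[L] w * h2

/-- **`j = −32768 = (−32)³` for a lattice with complex multiplication by `(1 + √−11)/2`**: if
`α² = α − 3` and `α⁻¹Λ = Λ ∪ (w + Λ) ∪ (−w + Λ)`, `w, 2w ∉ Λ`, then `128G₆² = 55G₄³`, whence
`j(Λ) = −32768` — the value `j((1 + √−11)/2) = −32³` of Cox's table (12.20), obtained here by the
method of §10.C. [cite: Cox2013, §12.C table (12.20) row d_K = -11 (method of §10.C (10.21)–(10.22))] -/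
theorem j_eq_of_cmThree_of_sq_eq_self_sub_three (hα2 : α ^ 2 = α - 3)
    (hΛ : ∀ x, α * x ∈ L.lattice ↔ x ∈ L.lattice ∨ x - w ∈ L.lattice ∨ x + w ∈ L.lattice)
    (hw : w ∉ L.lattice) (h2w : 2 * w ∉ L.lattice) :
    L.j = -32768 := by
  have hα : α ≠ 0 := by rintro rfl; norm_num at hα2
  have h4 : α ^ 4 = 6 - 5 * α := by
    linear_combination (α ^ 2 + α - 2) * hα2
  have h6 : α ^ 6 = 16 * α - 3 := by
    linear_combination (α ^ 4 + α ^ 3 - 2 * α ^ 2 - 5 * α + 1) * hα2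
  have e2 := weierstrassP_sq_of_cmThree hα hΛ hw h2w
  have e1 := G_six_of_cmThree hα hΛ hw h2w
  rw [h4] at e2 e1
  rw [h6] at e1
  have sq2 : 2 * (16 * α + 24) ^ 2 * L.G 6 ^ 2 = (15 - 5 * α) * (5 * α + 3) ^ 2 * L.G 4 ^ 3 := by
    have : ((16 * α - 3 + 27) * L.G 6) ^ 2 = ((6 - 5 * α - 9) * ℘[L] w * L.G 4) ^ 2 := by
      rw [e1]
    linear_combination 2 * this + (5 * α + 3) ^ 2 * L.G 4 ^ 2 * e2
  have key : (16 * α - 3) * (128 * L.G 6 ^ 2 - 55 * L.G 4 ^ 3) = 0 := by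
    linear_combination sq2 - 512 * L.G 6 ^ 2 * hα2 + (100 - 125 * α) * L.G 4 ^ 3 * hα2
  have h163 : 16 * α - 3 ≠ 0 := by
    intro h
    have hα' : α = 3 / 16 := by linear_combination h / 16
    rw [hα'] at hα2
    norm_num at hα2
  have hrel : 128 * L.G 6 ^ 2 - 55 * L.G 4 ^ 3 = 0 := (mul_eq_zero.mp key).resolve_left h163
  rw [j_def, div_eq_iff L.discr_ne_zero]
  simp only [g₂, g₃]
  linear_combination (-135475200) * hrel

end CMThree

end PeriodPair

end
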